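import Literature.Geometry.Lorentzian.CoordWeightedPoincare
import Literature.Geometry.Lorentzian.CoordConjugateHeat
import HarnessLib

/-!
# The exponentially weighted Poincaré inequality at a boundary (Chruściel–Delay 2003, Prop. C.4)

Topic `Literature/Geometry/Lorentzian`, coordinate tensor calculus `MetricCoord` (Riemannian metric
components `G` on an open set `V`). Everything here is PROVED; no definition and no statement of
`Prop` type is introduced.

Sequel of `CoordWeightedPoincare.lean` (Lemma C.1 / Prop. C.2 of Chruściel–Delay, Mém. SMF 94
(2003), App. C). For a "boundary defining function" `x` — any smooth function on `V`, the boundary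
being `{x = 0}` approached from `{x > 0}` — whose gradient is bounded below and whose Laplacian is
bounded on a collar `{0 < x < x₁}`, the weight `v = −s/x + t log x` in Prop. C.2 gives

* `lapAt_add_gradSqAt_boundaryWeight` — the computation of the proof of Prop. C.4:
  `Δv + |∇v|² = (s/x² + t/x) Δx + (s²/x⁴ + (2st − 2s)/x³ + (t² − t)/x²) |∇x|²`;
* **`IsMetricOn.integral_weightedPoincare_boundary`** — **Prop. C.4**: for all `s, t` and
  `ε > 0` there is `x₀ > 0` such that for every `u` smooth on `V` with compact support in
  `{0 < x < x₀}`,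
  `(s² − ε) ∫ √det g · e^{2v} x⁻⁴ |∇x|² u² dμ ≤ ∫ √det g · e^{2v} |∇u|² dμ`,
  `e^{2v} = e^{−2s/x} x^{2t}` — inequality (C.6), the scalar half of the coercivity estimate (3.4)
  near the boundary (Cor. D.5, Thm. 5.6) behind Thm. 5.9, i.e. behind the compact-annulus
  hypothesis `(E)` of `ChruscielDelay_parametricAnnulusGluing_of_compactCore`;
* `IsMetricOn.integrable_sqrtDetGram_mul_of_vanishing` — the integrability bookkeeping (a smooth
  density vanishing to first order with a compactly supported `u` is integrable against `√det g`).

## References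

* P. T. Chruściel, E. Delay, Mém. Soc. Math. Fr. 94 (2003), App. C, Prop. C.2, Prop. C.4, (C.6).
  [ChruscielDelay2003]
-/

noncomputable section

set_option maxSynthPendingDepth 3

open Set Filter Module Function MeasureTheory
open scoped Topology ContDiff

namespace Literature.Geometry.Lorentzian

namespace MetricCoord

variable {E : Type*} [NormedAddCommGroup E] [NormedSpace ℝ E] [FiniteDimensional ℝ E]
  [CompleteSpace E] {ι : Type*} [Fintype ι] [DecidableEq ι] (b : Basis ι ℝ E)
  {G : E → E →L[ℝ] E →L[ℝ] ℝ} {V : Set E} {x : E} {u : E → ℝ}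

/-! ### Restriction of metric components to an open subset -/

omit [FiniteDimensional ℝ E] [CompleteSpace E] in
/-- Metric components on `V` are metric components on every open `U ⊆ V` (local copy of
`IsMetricOn.mono`). [folklore] -/
private theorem IsMetricOn.mono' (hG : IsMetricOn G V) {U : Set E} (hU : IsOpen U) (hUV : U ⊆ V) :
    IsMetricOn G U :=
  ⟨hU, hG.contDiffOn.mono hUV, fun y hy ↦ hG.symm y (hUV hy), fun y hy ↦ hG.isInvertible y (hUV hy)⟩

/-! ### The weight `v = −s/x + t log x` -/

/-- The one-variable profile `g(r) = −s/r + t log r` and its first two derivatives on `r > 0`.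
[cite: ChruscielDelay2003, App. C, Prop. C.4] -/
private theorem hasDerivAt_cdBoundaryWeight (s t : ℝ) {r : ℝ} (hr : 0 < r) :
    HasDerivAt (fun r ↦ -s / r + t * Real.log r) (s / r ^ 2 + t / r) r := by
  have h1 : HasDerivAt (fun r : ℝ ↦ r⁻¹) (-(r ^ 2)⁻¹) r := hasDerivAt_inv hr.ne'
  have h2 : HasDerivAt Real.log r⁻¹ r := Real.hasDerivAt_log hr.ne'
  have h := ((h1.const_mul (-s)).fun_add (h2.const_mul t)).congr_deriv
    (g' := s / r ^ 2 + t / r) (by field_simp)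
  refine h.congr_of_eventuallyEq (Eventually.of_forall fun ρ ↦ ?_)
  simp only [div_eq_mul_inv, neg_mul]

/-- The derivative of `r ↦ s/r² + t/r` on `r > 0`. [folklore] -/
private theorem hasDerivAt_cdBoundaryWeight' (s t : ℝ) {r : ℝ} (hr : 0 < r) :
    HasDerivAt (fun r ↦ s / r ^ 2 + t / r) (-(2 * s) / r ^ 3 - t / r ^ 2) r := by
  have h1 : HasDerivAt (fun r : ℝ ↦ r⁻¹) (-(r ^ 2)⁻¹) r := hasDerivAt_inv hr.ne'
  have h2 : HasDerivAt (fun r : ℝ ↦ r⁻¹ ^ 2) ((2 : ℕ) * r⁻¹ ^ (2 - 1) * -(r ^ 2)⁻¹) r := h1.pow 2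
  have h := ((h2.const_mul s).fun_add (h1.const_mul t)).congr_deriv
    (g' := -(2 * s) / r ^ 3 - t / r ^ 2)
    (by simp only [Nat.cast_ofNat, Nat.add_one_sub_one, pow_one]; field_simp; ring)
  refine h.congr_of_eventuallyEq (Eventually.of_forall fun ρ ↦ ?_)
  simp only [div_eq_mul_inv, inv_pow]

/-- `g'(r) = s/r² + t/r` for `g(r) = −s/r + t log r`, `r > 0`. [folklore] -/
private theorem deriv_cdBoundaryWeight (s t : ℝ) {r : ℝ} (hr : 0 < r) :
    deriv (fun r ↦ -s / r + t * Real.log r) r = s / r ^ 2 + t / r :=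
  (hasDerivAt_cdBoundaryWeight s t hr).deriv

/-- `g''(r) = −2s/r³ − t/r²` for `g(r) = −s/r + t log r`, `r > 0`. [folklore] -/
private theorem deriv_deriv_cdBoundaryWeight (s t : ℝ) {r : ℝ} (hr : 0 < r) :
    deriv (deriv fun r ↦ -s / r + t * Real.log r) r = -(2 * s) / r ^ 3 - t / r ^ 2 := by
  have heq : deriv (fun r ↦ -s / r + t * Real.log r) =ᶠ[𝓝 r] fun r ↦ s / r ^ 2 + t / r := by
    filter_upwards [lt_mem_nhds hr] with ρ hρ
    exact deriv_cdBoundaryWeight s t hρ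
  rw [heq.deriv_eq, (hasDerivAt_cdBoundaryWeight' s t hr).deriv]

/-- `g(r) = −s/r + t log r` is `C²` at every `r > 0`. [folklore] -/
private theorem contDiffAt_cdBoundaryWeight (s t : ℝ) {r : ℝ} (hr : 0 < r) :
    ContDiffAt ℝ 2 (fun r ↦ -s / r + t * Real.log r) r := by
  have h1 : ContDiffAt ℝ 2 (fun r : ℝ ↦ r⁻¹) r := contDiffAt_inv ℝ hr.ne'
  have h2 : ContDiffAt ℝ 2 Real.log r := Real.contDiffAt_log.2 hr.ne'
  have h := (h1.const_smul (-s)).add (h2.const_smul t)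
  simpa [smul_eq_mul, div_eq_mul_inv, neg_mul] using h

omit [CompleteSpace E] in
/-- **The weight computation of Prop. C.4**: for `x` of class `C²` at `y` with `x y > 0` and
`v = −s/x + t log x`,
`Δv + |∇v|² = (s/x² + t/x) Δx + (s²/x⁴ + (2st − 2s)/x³ + (t² − t)/x²) |∇x|²`
(`Δ(g∘x) = g' Δx + g'' |∇x|²`, `|∇(g∘x)|² = g'² |∇x|²`). [cite: ChruscielDelay2003, App. C, Prop. C.4] -/
theorem lapAt_add_gradSqAt_boundaryWeight {xf : E → ℝ} {y : E} (s t : ℝ) (hy : 0 < xf y)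
    (hxf : ContDiffAt ℝ 2 xf y) :
    lapAt G (fun z ↦ -s / xf z + t * Real.log (xf z)) y
        + gradSqAt G (fun z ↦ -s / xf z + t * Real.log (xf z)) y =
      (s / xf y ^ 2 + t / xf y) * lapAt G xf y
        + (s ^ 2 / xf y ^ 4 + (2 * s * t - 2 * s) / xf y ^ 3 + (t ^ 2 - t) / xf y ^ 2)
          * gradSqAt G xf y := by
  rw [lapAt_comp_of_contDiffAt (g := fun r ↦ -s / r + t * Real.log r) (contDiffAt_cdBoundaryWeight s t hy) hxf,
    gradSqAt_comp_of_differentiableAt (g := fun r ↦ -s / r + t * Real.log r)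
      ((contDiffAt_cdBoundaryWeight s t hy).differentiableAt (by norm_num)) (hxf.differentiableAt (by norm_num)),
    deriv_cdBoundaryWeight s t hy, deriv_deriv_cdBoundaryWeight s t hy]
  have hx0 : xf y ≠ 0 := hy.ne'
  field_simp
  ring

/-! ### Integrability bookkeeping -/

omit [NormedSpace ℝ E] [FiniteDimensional ℝ E] [CompleteSpace E] [Fintype ι] [DecidableEq ι] in
/-- A function continuous at the points of `V` and locally zero off a compact subset of `V`
is continuous with compact support. [folklore] -/
private theorem continuous_and_hasCompactSupport_of' {k : E → ℝ} {S : Set E} (hSV : S ⊆ V)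
    (hS : IsCompact S) (hk : ∀ y ∈ V, ContinuousAt k y) (hk0 : ∀ y ∉ S, k =ᶠ[𝓝 y] fun _ ↦ 0) :
    Continuous k ∧ HasCompactSupport k := by
  refine ⟨continuous_iff_continuousAt.2 fun y ↦ ?_, ?_⟩
  · by_cases hy : y ∈ S
    · exact hk y (hSV hy)
    · exact (continuousAt_const.congr_of_eventuallyEq (hk0 y hy) :)
  · refine HasCompactSupport.of_support_subset_isCompact hS fun y hy ↦ ?_
    by_contra hyS
    exact hy (hk0 y hyS).self_of_nhds

omit [FiniteDimensional ℝ E] [CompleteSpace E] in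
/-- **Off its support a function vanishes to first order, locally.** [folklore] -/
theorem eventually_eq_zero_and_fderiv_eq_zero {y : E} (hy : y ∉ tsupport u) :
    ∀ᶠ z in 𝓝 y, u z = 0 ∧ fderiv ℝ u z = 0 := by
  have hyu : u =ᶠ[𝓝 y] fun _ ↦ 0 := notMem_tsupport_iff_eventuallyEq.mp hy
  obtain ⟨U, hU, hUo, hyU⟩ := mem_nhds_iff.1 hyu
  filter_upwards [hUo.mem_nhds hyU] with z hz
  have hzu : u =ᶠ[𝓝 z] fun _ ↦ 0 := Filter.eventually_of_mem (hUo.mem_nhds hz) fun t ht ↦ hU ht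
  exact ⟨hzu.self_of_nhds, by rw [hzu.fderiv_eq, fderiv_fun_const]; rfl⟩

section Integral

variable [MeasurableSpace E] [BorelSpace E] (μ : Measure E) [μ.IsAddHaarMeasure]

omit [FiniteDimensional ℝ E] [CompleteSpace E] in
/-- **Integrability bookkeeping**: for Riemannian metric components `G` on `V`, `u` smooth on `V`
with compact support inside `V` and a density `k` smooth on `V` vanishing wherever `u` and `du`
vanish, `√det g · k` is integrable (continuous with compact support). [folklore] -/
theorem IsMetricOn.integrable_sqrtDetGram_mul_of_vanishing (hG : IsMetricOn G V)
    (hpos : ∀ y ∈ V, ∀ e : E, e ≠ 0 → 0 < G y e e)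
    (hu : ContDiffOn ℝ ∞ u V) (hsupp : HasCompactSupport u) (huV : tsupport u ⊆ V)
    {k : E → ℝ} (hk : ContDiffOn ℝ ∞ k V) (hk0 : ∀ z, u z = 0 → fderiv ℝ u z = 0 → k z = 0) :
    Integrable (fun z ↦ sqrtDetGram G b z * k z) μ := by
  have _ := hu
  have hsg : ContDiffOn ℝ ∞ (sqrtDetGram G b) V := hG.contDiffOn_sqrtDetGram b hpos
  have cont : ∀ y ∈ V, ContinuousAt (fun z ↦ sqrtDetGram G b z * k z) y := fun y hy ↦
    ((hsg.continuousOn.continuousWithinAt hy).continuousAt (hG.mem_nhds hy)).mul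
      ((hk.continuousOn.continuousWithinAt hy).continuousAt (hG.mem_nhds hy))
  obtain ⟨hc, hcs⟩ := continuous_and_hasCompactSupport_of' huV hsupp cont fun y hy ↦
    (eventually_eq_zero_and_fderiv_eq_zero hy).mono fun z hz ↦ by
      simp only [hk0 z hz.1 hz.2, mul_zero]
  exact hc.integrable_of_hasCompactSupport hcs

/-! ### Prop. C.4 -/

/-- **The exponentially weighted Poincaré inequality at a boundary** (Chruściel–Delay 2003,
App. C, Prop. C.4, scalar case, in coordinates). Let `G` be Riemannian metric components on `V`
and `x` a smooth function on `V` with `m ≤ |∇x|²` and `|Δx| ≤ M` on the collar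
`{0 < x < x₁}` (`m > 0`). Then for all `s, t` and `ε > 0` there is `x₀ > 0` such that for every
`u` smooth on `V` with compact support inside `{0 < x < x₀}`,
`(s² − ε) ∫ √det g · e^{2v} x⁻⁴ |∇x|² u² dμ ≤ ∫ √det g · e^{2v} |∇u|² dμ`, `v = −s/x + t log x`
(so `e^{2v} = e^{−2s/x} x^{2t}`; this is (C.6)). Proof as printed: Prop. C.2 with this `v` and
`w = 0`, and `Δv + |∇v|² = (s² + o(1)) |∇x|²/x⁴` (`lapAt_add_gradSqAt_boundaryWeight`).
[cite: ChruscielDelay2003, App. C, Prop. C.4] -/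
theorem IsMetricOn.integral_weightedPoincare_boundary (hG : IsMetricOn G V)
    (hpos : ∀ y ∈ V, ∀ e : E, e ≠ 0 → 0 < G y e e) {xf : E → ℝ} (hxf : ContDiffOn ℝ ∞ xf V)
    {x₁ m M : ℝ} (hx₁ : 0 < x₁) (hm : 0 < m) (hM : 0 ≤ M)
    (hgrad : ∀ y ∈ V, 0 < xf y → xf y < x₁ → m ≤ gradSqAt G xf y)
    (hlap : ∀ y ∈ V, 0 < xf y → xf y < x₁ → |lapAt G xf y| ≤ M) (s t : ℝ) {ε : ℝ} (hε : 0 < ε) :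
    ∃ x₀ : ℝ, 0 < x₀ ∧ ∀ u : E → ℝ, ContDiffOn ℝ ∞ u V → HasCompactSupport u →
      tsupport u ⊆ {y ∈ V | 0 < xf y ∧ xf y < x₀} →
      (s ^ 2 - ε) * ∫ y, sqrtDetGram G b y *
          (Real.exp (2 * (-s / xf y + t * Real.log (xf y))) * (gradSqAt G xf y / xf y ^ 4)
            * u y ^ 2) ∂μ ≤
        ∫ y, sqrtDetGram G b y *
          (Real.exp (2 * (-s / xf y + t * Real.log (xf y))) * gradSqAt G u y) ∂μ := by
  -- the choice of the collar
  set A : ℝ := (|s| + |t|) * M + 1 with hA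
  set B' : ℝ := |2 * s * t - 2 * s| + |t ^ 2 - t| + 1 with hB'
  have hA0 : 0 < A := by positivity
  have hB0 : 0 < B' := by positivity
  set x₀ : ℝ := min (min 1 x₁) (min (ε * m / (2 * A)) (ε / (2 * B'))) with hx₀
  have hx₀pos : 0 < x₀ := by positivity
  have hx₀1 : x₀ ≤ 1 := (min_le_left _ _).trans (min_le_left _ _)
  have hx₀x₁ : x₀ ≤ x₁ := (min_le_left _ _).trans (min_le_right _ _)
  have hx₀A : x₀ ≤ ε * m / (2 * A) := (min_le_right _ _).trans (min_le_left _ _)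
  have hx₀B : x₀ ≤ ε / (2 * B') := (min_le_right _ _).trans (min_le_right _ _)
  refine ⟨x₀, hx₀pos, fun u hu hsupp huS ↦ ?_⟩
  -- the open collar `V' = V ∩ {x > 0}` and the weight
  set V' : Set E := {y ∈ V | 0 < xf y} with hV'
  have hV'o : IsOpen V' := by
    rw [hV', show {y ∈ V | 0 < xf y} = V ∩ xf ⁻¹' Ioi 0 from rfl]
    exact hxf.continuousOn.isOpen_inter_preimage hG.isOpen isOpen_Ioi
  have hV'V : V' ⊆ V := fun y hy ↦ hy.1
  have hG' : IsMetricOn G V' := hG.mono' hV'o hV'V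
  have hpos' : ∀ y ∈ V', ∀ e : E, e ≠ 0 → 0 < G y e e := fun y hy ↦ hpos y hy.1
  have huV' : tsupport u ⊆ V' := fun y hy ↦ ⟨(huS hy).1, (huS hy).2.1⟩
  have hu' : ContDiffOn ℝ ∞ u V' := hu.mono hV'V
  have hxf' : ContDiffOn ℝ ∞ xf V' := hxf.mono hV'V
  have hne : ∀ y ∈ V', xf y ≠ 0 := fun y hy ↦ hy.2.ne'
  set v : E → ℝ := fun y ↦ -s / xf y + t * Real.log (xf y) with hvdef
  have hv : ContDiffOn ℝ ∞ v V' := by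
    have h1 : ContDiffOn ℝ ∞ (fun y ↦ (xf y)⁻¹) V' := hxf'.inv hne
    have h2 : ContDiffOn ℝ ∞ (fun y ↦ Real.log (xf y)) V' := hxf'.log hne
    have h := (h1.const_smul (-s)).add (h2.const_smul t)
    refine h.congr fun y _ ↦ ?_
    simp only [hvdef, smul_eq_mul, div_eq_mul_inv, neg_mul]
  -- Prop. C.2 on the collar with `w = 0`
  have hC2 := hG'.integral_weightedPoincare b μ hpos' hu' hsupp huV' hv (contDiffOn_const (c := (0 : ℝ)))
  have h0g : ∀ y, gradSqAt G (fun _ : E ↦ (0 : ℝ)) y = 0 := fun y ↦ by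
    rw [gradSqAt_apply, fderiv_fun_const]; rfl
  simp only [lapAt_const, add_zero, h0g, sub_zero] at hC2
  -- the pointwise comparison of the weights on the collar
  have hpt : ∀ y ∈ V', xf y < x₀ →
      (s ^ 2 - ε) * (gradSqAt G xf y / xf y ^ 4) ≤ lapAt G v y + gradSqAt G v y := by
    intro y hy hyx
    have hx : 0 < xf y := hy.2
    have hx1 : xf y ≤ 1 := (hyx.le.trans hx₀1)
    have hxx₁ : xf y < x₁ := hyx.trans_le hx₀x₁
    have hg2 : m ≤ gradSqAt G xf y := hgrad y hy.1 hx hxx₁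
    have hL : |lapAt G xf y| ≤ M := hlap y hy.1 hx hxx₁
    have hxf2 : ContDiffAt ℝ 2 xf y :=
      ((hxf y hy.1).contDiffAt (hG.mem_nhds hy.1)).of_le (by norm_cast)
    rw [hvdef, lapAt_add_gradSqAt_boundaryWeight s t hx hxf2]
    -- reduce to a polynomial inequality in `x`, `Δx`, `|∇x|²`
    set X : ℝ := xf y with hX
    set L : ℝ := lapAt G xf y with hLdef
    set g2 : ℝ := gradSqAt G xf y with hg2def
    have hg2pos : 0 < g2 := hm.trans_le hg2
    have hX4 : 0 < X ^ 4 := by positivity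
    -- the two error terms
    have e1 : |(s * X ^ 2 + t * X ^ 3) * L| ≤ ε / 2 * g2 := by
      have h1 : |s * X ^ 2 + t * X ^ 3| ≤ (|s| + |t|) * X ^ 2 := by
        calc |s * X ^ 2 + t * X ^ 3| ≤ |s * X ^ 2| + |t * X ^ 3| := abs_add_le _ _
          _ = |s| * X ^ 2 + |t| * X ^ 3 := by
              rw [abs_mul, abs_mul, abs_of_pos (by positivity : 0 < X ^ 2),
                abs_of_pos (by positivity : 0 < X ^ 3)]
          _ ≤ |s| * X ^ 2 + |t| * X ^ 2 := by
              gcongr _ + |t| * ?_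
              calc X ^ 3 = X ^ 2 * X := by ring
                _ ≤ X ^ 2 * 1 := by gcongr
                _ = X ^ 2 := by ring
          _ = (|s| + |t|) * X ^ 2 := by ring
      have h2 : X ^ 2 ≤ X := by nlinarith
      have h3 : X ≤ ε * m / (2 * A) := hyx.le.trans hx₀A
      have h4 : (|s| + |t|) * M ≤ A := by rw [hA]; linarith
      have h5 : X ^ 2 ≤ ε * m / (2 * A) := h2.trans h3
      calc |(s * X ^ 2 + t * X ^ 3) * L| = |s * X ^ 2 + t * X ^ 3| * |L| := abs_mul _ _
        _ ≤ (|s| + |t|) * X ^ 2 * M := by gcongr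
        _ = (|s| + |t|) * M * X ^ 2 := by ring
        _ ≤ (|s| + |t|) * M * (ε * m / (2 * A)) := by gcongr
        _ ≤ A * (ε * m / (2 * A)) := by gcongr
        _ = ε / 2 * m := by field_simp
        _ ≤ ε / 2 * g2 := by gcongr
    have e2 : |((2 * s * t - 2 * s) * X + (t ^ 2 - t) * X ^ 2) * g2| ≤ ε / 2 * g2 := by
      have h1 : |(2 * s * t - 2 * s) * X + (t ^ 2 - t) * X ^ 2| ≤ B' * X := by
        calc |(2 * s * t - 2 * s) * X + (t ^ 2 - t) * X ^ 2|
            ≤ |(2 * s * t - 2 * s) * X| + |(t ^ 2 - t) * X ^ 2| := abs_add_le _ _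
          _ = |2 * s * t - 2 * s| * X + |t ^ 2 - t| * X ^ 2 := by
              rw [abs_mul, abs_mul, abs_of_pos hx, abs_of_pos (by positivity : 0 < X ^ 2)]
          _ ≤ |2 * s * t - 2 * s| * X + |t ^ 2 - t| * X := by
              gcongr _ + |t ^ 2 - t| * ?_
              nlinarith
          _ ≤ B' * X := by rw [hB']; nlinarith [abs_nonneg (2 * s * t - 2 * s), abs_nonneg (t ^ 2 - t)]
      have h3 : X ≤ ε / (2 * B') := hyx.le.trans hx₀B
      calc |((2 * s * t - 2 * s) * X + (t ^ 2 - t) * X ^ 2) * g2|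
          = |(2 * s * t - 2 * s) * X + (t ^ 2 - t) * X ^ 2| * g2 := by
            rw [abs_mul, abs_of_pos hg2pos]
        _ ≤ B' * X * g2 := by gcongr
        _ ≤ B' * (ε / (2 * B')) * g2 := by gcongr
        _ = ε / 2 * g2 := by field_simp
    -- conclude
    have key : (s ^ 2 - ε) * g2 ≤
        (s * X ^ 2 + t * X ^ 3) * L + (s ^ 2 + (2 * s * t - 2 * s) * X + (t ^ 2 - t) * X ^ 2) * g2 := by
      have a1 := neg_abs_le ((s * X ^ 2 + t * X ^ 3) * L)
      have a2 := neg_abs_le (((2 * s * t - 2 * s) * X + (t ^ 2 - t) * X ^ 2) * g2)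
      nlinarith [a1, a2, e1, e2]
    have hX0 : X ≠ 0 := hx.ne'
    rw [mul_div_assoc', div_le_iff₀ hX4]
    calc (s ^ 2 - ε) * g2 ≤ (s * X ^ 2 + t * X ^ 3) * L
          + (s ^ 2 + (2 * s * t - 2 * s) * X + (t ^ 2 - t) * X ^ 2) * g2 := key
      _ = ((s / X ^ 2 + t / X) * L
          + (s ^ 2 / X ^ 4 + (2 * s * t - 2 * s) / X ^ 3 + (t ^ 2 - t) / X ^ 2) * g2) * X ^ 4 := by
          field_simp
  -- integrate the pointwise comparison
  have hI₁ : Integrable (fun y ↦ sqrtDetGram G b y * ((s ^ 2 - ε) *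
      (Real.exp (2 * v y) * (gradSqAt G xf y / xf y ^ 4) * u y ^ 2))) μ := by
    refine hG'.integrable_sqrtDetGram_mul_of_vanishing b μ hpos' hu' hsupp huV' ?_ fun z hz _ ↦ ?_
    · exact contDiffOn_const.mul ((((contDiffOn_const.mul hv).exp).mul
        ((hG'.contDiffOn_gradSqAt hxf').div (hxf'.pow 4) fun y hy ↦ pow_ne_zero 4 (hne y hy))).mul
        (hu'.pow 2))
    · simp only [hz]; ring
  have hI₂ : Integrable (fun y ↦ sqrtDetGram G b y *
      (Real.exp (2 * v y) * (lapAt G v y + gradSqAt G v y) * u y ^ 2)) μ := by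
    refine hG'.integrable_sqrtDetGram_mul_of_vanishing b μ hpos' hu' hsupp huV' ?_ fun z hz _ ↦ ?_
    · exact (((contDiffOn_const.mul hv).exp).mul
        ((hG'.contDiffOn_lapAt hv).add (hG'.contDiffOn_gradSqAt hv))).mul (hu'.pow 2)
    · simp only [hz]; ring
  have hmono : ∫ y, sqrtDetGram G b y * ((s ^ 2 - ε) *
      (Real.exp (2 * v y) * (gradSqAt G xf y / xf y ^ 4) * u y ^ 2)) ∂μ ≤
      ∫ y, sqrtDetGram G b y * (Real.exp (2 * v y) * (lapAt G v y + gradSqAt G v y) * u y ^ 2) ∂μ := by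
    refine integral_mono hI₁ hI₂ fun y ↦ ?_
    show sqrtDetGram G b y * ((s ^ 2 - ε) *
      (Real.exp (2 * v y) * (gradSqAt G xf y / xf y ^ 4) * u y ^ 2)) ≤
      sqrtDetGram G b y * (Real.exp (2 * v y) * (lapAt G v y + gradSqAt G v y) * u y ^ 2)
    by_cases hy : y ∈ tsupport u
    · have hyV' := huV' hy
      have hw : 0 ≤ sqrtDetGram G b y * (Real.exp (2 * v y) * u y ^ 2) :=
        mul_nonneg (Real.sqrt_nonneg _) (mul_nonneg (Real.exp_nonneg _) (sq_nonneg _))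
      have h := mul_le_mul_of_nonneg_left (hpt y hyV' (huS hy).2.2) hw
      calc sqrtDetGram G b y * ((s ^ 2 - ε) *
            (Real.exp (2 * v y) * (gradSqAt G xf y / xf y ^ 4) * u y ^ 2))
          = sqrtDetGram G b y * (Real.exp (2 * v y) * u y ^ 2) *
            ((s ^ 2 - ε) * (gradSqAt G xf y / xf y ^ 4)) := by ring
        _ ≤ sqrtDetGram G b y * (Real.exp (2 * v y) * u y ^ 2) * (lapAt G v y + gradSqAt G v y) := h
        _ = sqrtDetGram G b y * (Real.exp (2 * v y) * (lapAt G v y + gradSqAt G v y) * u y ^ 2) := by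
            ring
    · have h0 : u y = 0 := (eventually_eq_zero_and_fderiv_eq_zero hy).self_of_nhds.1
      simp only [h0]
      ring_nf
      rfl
  rw [← integral_const_mul]
  calc ∫ y, (s ^ 2 - ε) * (sqrtDetGram G b y *
        (Real.exp (2 * (-s / xf y + t * Real.log (xf y))) * (gradSqAt G xf y / xf y ^ 4) * u y ^ 2)) ∂μ
      = ∫ y, sqrtDetGram G b y * ((s ^ 2 - ε) *
        (Real.exp (2 * v y) * (gradSqAt G xf y / xf y ^ 4) * u y ^ 2)) ∂μ := by
        congr 1; ext y; simp only [hvdef]; ring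
    _ ≤ _ := hmono
    _ ≤ _ := hC2

end Integral

end MetricCoord

end Literature.Geometry.Lorentzian

end
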